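import Literature.NumberTheory.NumberFields.RayClassFieldSplitPrimePowerDegree
import Literature.NumberTheory.LFunctions.IdealNormCount
import Literature.NumberTheory.EllipticCurves.HeegnerPointsImaginaryQuadraticProofs
import Literature.NumberTheory.EllipticCurves.RingClassFieldTower
import HarnessLib

/-!
# `[K(𝔣𝔭^{n+1}) : K(𝔣𝔭)] = p^n` for an imaginary quadratic `K` and a SPLIT prime `p = 𝔭𝔭̄`
# (de Shalit 1987, II.1.9) — the hypotheses discharged from the binders of the `p = 2` cell

`RayClassFieldSplitPrimePowerDegree.lean` proves `[K(𝔣𝔭^{n+1}) : K(𝔣𝔭)] = p^n` for any totally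
complex `K` under three hypotheses on `𝔭 = v`: residue degree one (`#(𝓞/𝔭) = p`), unramified over `p`
(`v_𝔭(p) = 1`), and `w_{𝔣𝔭} = 1` (no unit `≠ 1` is `≡ 1 mod 𝔣𝔭`). This file discharges them from the
binders under which the split-prime Iwasawa theory of an imaginary quadratic field is stated in the
tree (`[K:ℚ] = 2`, `p ∈ 𝔭`, `p ∈ 𝔭̄`, `𝔭̄ ≠ 𝔭`; `#𝓞_K^× = 2`, i.e. `d_K < -4`):

* §1 **split primes of a quadratic field** — `absNorm_eq_of_mem_of_mem_of_ne`: `N(𝔭) = p`;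
  `natCard_quotient_eq_of_mem_of_mem_of_ne`: `#(𝓞/𝔭) = p`; `natCast_not_mem_sq_of_mem_of_mem_of_ne`:
  `p ∉ 𝔭²`; `intValuation_natCast_eq_of_mem_of_mem_of_ne`: `v_𝔭(p) = 1` (norms: `N(𝔭)N(𝔭̄) ∣ N((p)) = p²`
  with both factors `> 1`, and `N(𝔭²𝔭̄) = p³ ∤ p²`);
* §2 **`w_𝔪 = 1`** — `units_eq_one_or_eq_neg_one_of_natCard_eq_two`: `#𝓞^× = 2 ⟹ 𝓞^× = {±1}`;
  `units_eq_one_of_sub_one_mem_of_natCard_eq_two`: if moreover `2 ∉ 𝔪` then `w_𝔪 = 1`;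
* §3 ★ the statements for `[K:ℚ] = 2`, `K` totally complex, `#𝓞_K^× = 2`, `p = 𝔭𝔭̄` split,
  `𝔣 ≠ 0` prime to `𝔭` with `2 ∉ 𝔣𝔭`: `natCard_rayClassGroup_mul_pow_succ_of_split`
  (`#Cl^{𝔣𝔭^{n+1}} = #Cl^{𝔣𝔭}·p^n`), and the `IsImaginaryQuadratic K`, `d_K < -4` wrappers
  ★★ `relIndex_fixingSubgroup_rayClassField_mul_pow_succ_of_isImaginaryQuadratic` (Galois form; the
  cell's `K = ℚ(√-7)`, `p = 2 = v v̄`: `[Gal(K̄/K(𝔣v)) : Gal(K̄/K(𝔣v^{n+1}))] = 2^n`),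
  `relfinrank_rayClassField_mul_pow_succ_of_isImaginaryQuadratic` (`[K(𝔣v^{n+1}) : K(𝔣v)] = p^n`),
  `natCard_rayClassGroup_mul_pow_succ_of_isImaginaryQuadratic`. (The plain degree forms under the
  `[K:ℚ] = 2` hypotheses are `relfinrank_rayClassField_mul_pow_succ` /
  `relIndex_fixingSubgroup_rayClassField_mul_pow_succ` fed with §1–§2.)

Everything is a theorem; no definitions, no named facts, no instances, no `sorry`.
-/

noncomputable section

open NumberField IsDedekindDomain IsDedekindDomain.HeightOneSpectrum IntermediateField Module

namespace Literature.NumberTheory.NumberFields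

open Literature.NumberTheory.GaloisRepresentations Literature.NumberTheory.LFunctions

/-! ### §1. Split primes of a quadratic field: degree one, unramified -/

section Split

variable {K : Type*} [Field K] [NumberField K]

/-- **`N(𝔭) = p` at a split prime of a quadratic field**: `[K:ℚ] = 2`, `p ∈ 𝔭`, `p ∈ 𝔭̄`, `𝔭̄ ≠ 𝔭`
give `N(𝔭) = p` (`N(𝔭)N(𝔭̄) ∣ N((p)) = p²`, both factors `> 1`).
[cite: NeukirchANT1999, Ch. I §8 Prop. (8.2), (8.3)] -/
theorem absNorm_eq_of_mem_of_mem_of_ne (hK2 : finrank ℚ K = 2) {p : ℕ} (hp : p.Prime)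
    {v vbar : HeightOneSpectrum (𝓞 K)} (hv : ((p : ℕ) : 𝓞 K) ∈ v.asIdeal)
    (hvbar : ((p : ℕ) : 𝓞 K) ∈ vbar.asIdeal) (hne : vbar ≠ v) : Ideal.absNorm v.asIdeal = p := by
  have hP : Ideal.absNorm (Ideal.span {((p : ℕ) : 𝓞 K)}) = p ^ 2 := by
    rw [IdealNormCount.absNorm_span_natCast K p, hK2]
  have hcop : IsCoprime v.asIdeal vbar.asIdeal := (Ideal.isCoprime_iff_sup_eq).mpr
    (Ideal.IsMaximal.coprime_of_ne v.isMaximal vbar.isMaximal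
      (fun h ↦ hne (HeightOneSpectrum.ext h.symm)))
  have hle : Ideal.span {((p : ℕ) : 𝓞 K)} ≤ v.asIdeal * vbar.asIdeal := by
    rw [Ideal.mul_eq_inf_of_isCoprime hcop, le_inf_iff, Ideal.span_singleton_le_iff_mem,
      Ideal.span_singleton_le_iff_mem]
    exact ⟨hv, hvbar⟩
  have hdvd : Ideal.absNorm v.asIdeal * Ideal.absNorm vbar.asIdeal ∣ p ^ 2 := by
    rw [← map_mul, ← hP]
    exact Ideal.absNorm_dvd_absNorm_of_le hle
  have hv1 : Ideal.absNorm v.asIdeal ≠ 1 := fun h ↦ v.isPrime.ne_top (Ideal.absNorm_eq_one_iff.mp h)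
  have hvbar1 : Ideal.absNorm vbar.asIdeal ≠ 1 := fun h ↦
    vbar.isPrime.ne_top (Ideal.absNorm_eq_one_iff.mp h)
  obtain ⟨a, ha, hav⟩ := (Nat.dvd_prime_pow hp).mp (dvd_of_mul_right_dvd hdvd)
  obtain ⟨b, hb, hbv⟩ := (Nat.dvd_prime_pow hp).mp (dvd_of_mul_left_dvd hdvd)
  rw [hav, hbv, ← pow_add, Nat.pow_dvd_pow_iff_le_right hp.one_lt] at hdvd
  have ha0 : a ≠ 0 := fun h ↦ hv1 (by rw [hav, h, pow_zero])
  have hb0 : b ≠ 0 := fun h ↦ hvbar1 (by rw [hbv, h, pow_zero])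
  have ha1 : a = 1 := by omega
  rw [hav, ha1, pow_one]

/-- `#(𝓞/𝔭) = p` (residue degree one) at a split prime of a quadratic field.
[cite: NeukirchANT1999, Ch. I §8 Prop. (8.2), (8.3)] -/
theorem natCard_quotient_eq_of_mem_of_mem_of_ne (hK2 : finrank ℚ K = 2) {p : ℕ} (hp : p.Prime)
    {v vbar : HeightOneSpectrum (𝓞 K)} (hv : ((p : ℕ) : 𝓞 K) ∈ v.asIdeal)
    (hvbar : ((p : ℕ) : 𝓞 K) ∈ vbar.asIdeal) (hne : vbar ≠ v) : Nat.card (𝓞 K ⧸ v.asIdeal) = p := by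
  rw [← Submodule.cardQuot_apply, ← Ideal.absNorm_apply]
  exact absNorm_eq_of_mem_of_mem_of_ne hK2 hp hv hvbar hne

/-- **`p ∉ 𝔭²` at a split prime of a quadratic field** (`p` is unramified: `N(𝔭²𝔭̄) = p³ ∤ N((p)) = p²`).
[cite: NeukirchANT1999, Ch. I §8 Prop. (8.2), (8.3)] -/
theorem natCast_not_mem_sq_of_mem_of_mem_of_ne (hK2 : finrank ℚ K = 2) {p : ℕ} (hp : p.Prime)
    {v vbar : HeightOneSpectrum (𝓞 K)} (hv : ((p : ℕ) : 𝓞 K) ∈ v.asIdeal)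
    (hvbar : ((p : ℕ) : 𝓞 K) ∈ vbar.asIdeal) (hne : vbar ≠ v) :
    ((p : ℕ) : 𝓞 K) ∉ v.asIdeal ^ 2 := by
  intro h2
  have hP : Ideal.absNorm (Ideal.span {((p : ℕ) : 𝓞 K)}) = p ^ 2 := by
    rw [IdealNormCount.absNorm_span_natCast K p, hK2]
  have hcop : IsCoprime (v.asIdeal ^ 2) vbar.asIdeal := IsCoprime.pow_left
    ((Ideal.isCoprime_iff_sup_eq).mpr (Ideal.IsMaximal.coprime_of_ne v.isMaximal vbar.isMaximal
      (fun h ↦ hne (HeightOneSpectrum.ext h.symm))))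
  have hle : Ideal.span {((p : ℕ) : 𝓞 K)} ≤ v.asIdeal ^ 2 * vbar.asIdeal := by
    rw [Ideal.mul_eq_inf_of_isCoprime hcop, le_inf_iff, Ideal.span_singleton_le_iff_mem,
      Ideal.span_singleton_le_iff_mem]
    exact ⟨h2, hvbar⟩
  have hdvd : Ideal.absNorm (v.asIdeal ^ 2) * Ideal.absNorm vbar.asIdeal ∣ p ^ 2 := by
    rw [← map_mul, ← hP]
    exact Ideal.absNorm_dvd_absNorm_of_le hle
  rw [map_pow, absNorm_eq_of_mem_of_mem_of_ne hK2 hp hv hvbar hne,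
    absNorm_eq_of_mem_of_mem_of_ne hK2 hp hvbar hv hne.symm, ← pow_succ,
    Nat.pow_dvd_pow_iff_le_right hp.one_lt] at hdvd
  omega

/-- **`v_𝔭(p) = 1` at a split prime of a quadratic field** (`p ∈ 𝔭`, `p ∉ 𝔭²`): `p` is a uniformiser
of `K_𝔭 = ℚ_p`. [cite: NeukirchANT1999, Ch. I §8 Prop. (8.2), (8.3)] [cite: deShalit1987, II.1.1 (p. 38)] -/
theorem intValuation_natCast_eq_of_mem_of_mem_of_ne (hK2 : finrank ℚ K = 2) {p : ℕ} (hp : p.Prime)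
    {v vbar : HeightOneSpectrum (𝓞 K)} (hv : ((p : ℕ) : 𝓞 K) ∈ v.asIdeal)
    (hvbar : ((p : ℕ) : 𝓞 K) ∈ vbar.asIdeal) (hne : vbar ≠ v) :
    v.intValuation ((p : ℕ) : 𝓞 K) = WithZero.exp (-1 : ℤ) := by
  have hp0 : ((p : ℕ) : 𝓞 K) ≠ 0 := by exact_mod_cast hp.ne_zero
  refine le_antisymm ?_ ?_
  · rw [show (-1 : ℤ) = -((1 : ℕ) : ℤ) by norm_num, intValuation_le_pow_iff_mem, pow_one]
    exact hv
  · by_contra hlt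
    rw [not_le] at hlt
    have hne0 : v.intValuation ((p : ℕ) : 𝓞 K) ≠ 0 := v.intValuation_ne_zero _ hp0
    obtain ⟨m, hm⟩ : ∃ m : ℤ, v.intValuation ((p : ℕ) : 𝓞 K) = WithZero.exp m :=
      ⟨WithZero.log (v.intValuation ((p : ℕ) : 𝓞 K)), (WithZero.exp_log hne0).symm⟩
    rw [hm, WithZero.exp_lt_exp] at hlt
    have h2 : v.intValuation ((p : ℕ) : 𝓞 K) ≤ WithZero.exp (-((2 : ℕ) : ℤ)) := by
      rw [hm, WithZero.exp_le_exp]; omega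
    rw [intValuation_le_pow_iff_mem] at h2
    exact natCast_not_mem_sq_of_mem_of_mem_of_ne hK2 hp hv hvbar hne h2

end Split

/-! ### §2. `w_𝔪 = 1` from `#𝓞^× = 2` and `2 ∉ 𝔪` -/

section Units

variable {K : Type*} [Field K] [NumberField K]

/-- `#𝓞_K^× = 2 ⟹ 𝓞_K^× = {±1}`. [cite: Cox2013, §7.D Thm. 7.24 (units)] -/
theorem units_eq_one_or_eq_neg_one_of_natCard_eq_two (h : Nat.card (𝓞 K)ˣ = 2) (u : (𝓞 K)ˣ) :
    u = 1 ∨ u = -1 := by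
  have hne : (-1 : (𝓞 K)ˣ) ≠ 1 := fun h1 ↦ by
    have h1' := congrArg (fun w : (𝓞 K)ˣ ↦ ((w : 𝓞 K) : K)) h1
    simp only [Units.val_neg, Units.val_one] at h1'
    norm_num at h1'
  obtain ⟨y, hy, huniq⟩ := (Nat.card_eq_two_iff' (1 : (𝓞 K)ˣ)).mp h
  rcases eq_or_ne u 1 with hu | hu
  · exact Or.inl hu
  · exact Or.inr ((huniq u hu).trans (huniq (-1) hne).symm)

/-- **`w_𝔪 = 1`**: if `#𝓞_K^× = 2` and `2 ∉ 𝔪` then no unit `≠ 1` is `≡ 1 mod 𝔪` (`-1 ≡ 1` would put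
`2 ∈ 𝔪`). [cite: deShalit1987, II.1.9 (p. 43)] [cite: Cox2013, §7.D Thm. 7.24 (units)] -/
theorem units_eq_one_of_sub_one_mem_of_natCard_eq_two (h : Nat.card (𝓞 K)ˣ = 2) {𝔪 : Ideal (𝓞 K)}
    (h2 : (2 : 𝓞 K) ∉ 𝔪) (u : (𝓞 K)ˣ) (hu : (u : 𝓞 K) - 1 ∈ 𝔪) : u = 1 := by
  rcases units_eq_one_or_eq_neg_one_of_natCard_eq_two h u with rfl | rfl
  · rfl
  · exfalso
    apply h2
    have : ((-1 : (𝓞 K)ˣ) : 𝓞 K) - 1 = -2 := by rw [Units.val_neg, Units.val_one]; norm_num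
    rw [this] at hu
    simpa using 𝔪.neg_mem hu

end Units

/-! ### §3. The degree statements at a split prime of an imaginary quadratic field -/

section Quadratic

open Literature.NumberTheory.EllipticCurves

variable {K : Type*} [Field K] [NumberField K] [IsTotallyComplex K] (hK2 : finrank ℚ K = 2)
  (hunits : Nat.card (𝓞 K)ˣ = 2) {p : ℕ} [Fact p.Prime] {v vbar : HeightOneSpectrum (𝓞 K)}
  (hv : ((p : ℕ) : 𝓞 K) ∈ v.asIdeal) (hvbar : ((p : ℕ) : 𝓞 K) ∈ vbar.asIdeal) (hne : vbar ≠ v)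
  {𝔣 : Ideal (𝓞 K)} (h𝔣 : 𝔣 ≠ ⊥) (hcop : IsCoprime 𝔣 v.asIdeal) (h2 : (2 : 𝓞 K) ∉ 𝔣 * v.asIdeal)
include hK2 hunits hv hvbar hne h𝔣 hcop h2

/-- ★ **`#Cl_K^{𝔣𝔭^{n+1}} = #Cl_K^{𝔣𝔭} · p^n`** for `[K:ℚ] = 2` totally complex with `#𝓞_K^× = 2`,
`p = 𝔭𝔭̄` split (`p ∈ 𝔭, 𝔭̄`, `𝔭̄ ≠ 𝔭`), `𝔣 ≠ 0` prime to `𝔭`, `2 ∉ 𝔣𝔭`.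
[cite: deShalit1987, II.1.9 (p. 43)] -/
theorem natCard_rayClassGroup_mul_pow_succ_of_split (n : ℕ) :
    Nat.card (RayClassGroup (𝔣 * v.asIdeal ^ (n + 1))) =
      Nat.card (RayClassGroup (𝔣 * v.asIdeal)) * p ^ n :=
  natCard_rayClassGroup_mul_pow_eq v
    (natCard_quotient_eq_of_mem_of_mem_of_ne hK2 (Fact.out : p.Prime) hv hvbar hne)
    (intValuation_natCast_eq_of_mem_of_mem_of_ne hK2 (Fact.out : p.Prime) hv hvbar hne) h𝔣 hcop
    (units_eq_one_of_sub_one_mem_of_natCard_eq_two hunits h2) n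

end Quadratic

section ImaginaryQuadratic

open Literature.NumberTheory.EllipticCurves

/-- ★★ **The cell's instance (`K = ℚ(√-7)`, `2 = v v̄`): `[Gal(K̄/K(𝔣v)) : Gal(K̄/K(𝔣v^{n+1}))] = p^n`**
for `K` imaginary quadratic with `d_K < -4` (so `𝓞_K^× = {±1}`), `p ∈ v`, `p ∈ v̄`, `v̄ ≠ v`, `𝔣 ≠ 0`
prime to `v` with `2 ∉ 𝔣v` — de Shalit II.1.9 `Gal(K(𝔣𝔭^{n+1})/K(𝔣𝔭)) ≅ (1+p ℤ_p)/(1+p^{n+1}ℤ_p)`.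
[cite: deShalit1987, II.1.9 (p. 43), II.4.6 (p. 59)] -/
theorem relIndex_fixingSubgroup_rayClassField_mul_pow_succ_of_isImaginaryQuadratic {K : Type}
    [Field K] [NumberField K] (hK : IsImaginaryQuadratic K) (hd : NumberField.discr K < -4) {p : ℕ}
    [Fact p.Prime] {v vbar : HeightOneSpectrum (𝓞 K)} (hv : ((p : ℕ) : 𝓞 K) ∈ v.asIdeal)
    (hvbar : ((p : ℕ) : 𝓞 K) ∈ vbar.asIdeal) (hne : vbar ≠ v) {𝔣 : Ideal (𝓞 K)} (h𝔣 : 𝔣 ≠ ⊥)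
    (hcop : IsCoprime 𝔣 v.asIdeal) (h2 : (2 : 𝓞 K) ∉ 𝔣 * v.asIdeal) (n : ℕ) :
    (rayClassField K (𝔣 * v.asIdeal ^ (n + 1))).fixingSubgroup.relIndex
      (rayClassField K (𝔣 * v.asIdeal)).fixingSubgroup = p ^ n := by
  haveI := hK.isTotallyComplex
  exact relIndex_fixingSubgroup_rayClassField_mul_pow_succ v
    (natCard_quotient_eq_of_mem_of_mem_of_ne hK.1 (Fact.out : p.Prime) hv hvbar hne)
    (intValuation_natCast_eq_of_mem_of_mem_of_ne hK.1 (Fact.out : p.Prime) hv hvbar hne) h𝔣 hcop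
    (units_eq_one_of_sub_one_mem_of_natCard_eq_two (card_units_eq_two_of_discr_lt hK hd) h2) n

/-- `[K(𝔣v^{n+1}) : K(𝔣v)] = p^n` (`IntermediateField.relfinrank` form) for `K` imaginary quadratic with
`d_K < -4`, `p = v v̄` split, `𝔣 ≠ 0` prime to `v`, `2 ∉ 𝔣v`. [cite: deShalit1987, II.1.9 (p. 43)] -/
theorem relfinrank_rayClassField_mul_pow_succ_of_isImaginaryQuadratic {K : Type}
    [Field K] [NumberField K] (hK : IsImaginaryQuadratic K) (hd : NumberField.discr K < -4) {p : ℕ}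
    [Fact p.Prime] {v vbar : HeightOneSpectrum (𝓞 K)} (hv : ((p : ℕ) : 𝓞 K) ∈ v.asIdeal)
    (hvbar : ((p : ℕ) : 𝓞 K) ∈ vbar.asIdeal) (hne : vbar ≠ v) {𝔣 : Ideal (𝓞 K)} (h𝔣 : 𝔣 ≠ ⊥)
    (hcop : IsCoprime 𝔣 v.asIdeal) (h2 : (2 : 𝓞 K) ∉ 𝔣 * v.asIdeal) (n : ℕ) :
    relfinrank (rayClassField K (𝔣 * v.asIdeal)) (rayClassField K (𝔣 * v.asIdeal ^ (n + 1))) =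
      p ^ n := by
  haveI := hK.isTotallyComplex
  exact relfinrank_rayClassField_mul_pow_succ v
    (natCard_quotient_eq_of_mem_of_mem_of_ne hK.1 (Fact.out : p.Prime) hv hvbar hne)
    (intValuation_natCast_eq_of_mem_of_mem_of_ne hK.1 (Fact.out : p.Prime) hv hvbar hne) h𝔣 hcop
    (units_eq_one_of_sub_one_mem_of_natCard_eq_two (card_units_eq_two_of_discr_lt hK hd) h2) n

/-- `#Cl_K^{𝔣v^{n+1}} = #Cl_K^{𝔣v} · p^n` for `K` imaginary quadratic with `d_K < -4`, `p = v v̄` split,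
`𝔣 ≠ 0` prime to `v`, `2 ∉ 𝔣v`. [cite: deShalit1987, II.1.9 (p. 43)] -/
theorem natCard_rayClassGroup_mul_pow_succ_of_isImaginaryQuadratic {K : Type}
    [Field K] [NumberField K] (hK : IsImaginaryQuadratic K) (hd : NumberField.discr K < -4) {p : ℕ}
    [Fact p.Prime] {v vbar : HeightOneSpectrum (𝓞 K)} (hv : ((p : ℕ) : 𝓞 K) ∈ v.asIdeal)
    (hvbar : ((p : ℕ) : 𝓞 K) ∈ vbar.asIdeal) (hne : vbar ≠ v) {𝔣 : Ideal (𝓞 K)} (h𝔣 : 𝔣 ≠ ⊥)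
    (hcop : IsCoprime 𝔣 v.asIdeal) (h2 : (2 : 𝓞 K) ∉ 𝔣 * v.asIdeal) (n : ℕ) :
    Nat.card (RayClassGroup (𝔣 * v.asIdeal ^ (n + 1))) =
      Nat.card (RayClassGroup (𝔣 * v.asIdeal)) * p ^ n := by
  haveI := hK.isTotallyComplex
  exact natCard_rayClassGroup_mul_pow_succ_of_split hK.1
    (card_units_eq_two_of_discr_lt hK hd) hv hvbar hne h𝔣 hcop h2 n

end ImaginaryQuadratic

end Literature.NumberTheory.NumberFields

end
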